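import Summits.ResolutionOfSingularities.ResolutionOfSingularities.Theorems.PurelyInseparableDim4PureLeafTransitionsL
import HarnessLib
import HarnessLib.Audit.Tags

/-!
# Purely inseparable fourfolds — TRANSITIONS of the normal forms under the PAIR blow-up `{x_j, x_k}` over `𝔽₂`
# (cell res-dim4-pi; D3b, case (U2) of `HOME/res-dim4-p-10/D3b-PAPER.md` §2)
# [OURS · counted 0 · bookkeeping identities of OUR frame, not about resolution]

Width seat `res-dim4-p-10` (g2).  Last piece of the transition ALGEBRA of the paper proof «pure leaves win the global game
over `𝔽₂`»: the pair move (U2) — a product state `N(a,e)` in which `x_j` and `x_k` are PURE factors of exponent `1`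
(`a_j = a_k = 1`, `e_j = e_k = 0`, `j ≠ k`; by invariant (I6) of the memo this is the situation whenever no singleton
centre is permissible), the centre `{x_j, x_k}`, the chart `x_j`, any translation vector `b` (the frame has `b_j = 0`; not needed for the algebra):

* `prod_eq_XX_mul` — `N(a,e) = x_j x_k · N(a − δ_j − δ_k, e)` with the cofactor supported off `{j,k}`;
* `chartTransform_pair_XX` — `chartTransform 2 {j,k} j (x_j x_k) = x_k`;
* **`pointTransform_pair`** — the uncleaned transform is the normal form `N(a′,e′)` with `a′ = swap_b(a with a_j := 0)`,
  `e′ = swap_b e` — exactly the shape of (U1) with `a_j ↦ 0` in place of `a_j ↦ a_j − 2`, so the cleaning outcomes are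
  `sub_deletePthPowers_of_purelyOdd` / `sub_deletePthPowers_of_forall_even` of `…PureLeafTransitions` verbatim
  (`step_F_pair_of_purelyOdd`, `step_F_pair_of_forall_even`).

Nothing here proves resolution of singularities in dimension ≥ 4 / characteristic `p`; counted 0; AI work, weaker than
expert review. bears_on: LADDER-RESOLUTION:D157-DOOR2 (res-dim4-pi · WORD #60 D3b). Supports
stmt-ResolutionOfSingularities-16155 (helper).
-/

set_option linter.dupNamespace false

open MvPolynomial Finset

open scoped BigOperators

noncomputable section

namespace Summit.ResolutionOfSingularities.ResolutionOfSingularities.Theorems.PIDim4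

namespace PureLeafNF

open Literature.AlgebraicGeometry.Resolution
open Literature.AlgebraicGeometry.Resolution.Hauser2010
open CentreBlowup PthPowerFactor

variable {σ : Type*} [Fintype σ] [DecidableEq σ]

/-! ## 1. Pulling out `x_j x_k` -/

/-- If `a_j = a_k = 1` and `e_j = e_k = 0` (`j ≠ k`) then `N(a,e) = x_j x_k · N(ã, e)` with `ã = a` zeroed at `j, k`.
[folklore] -/
theorem prod_eq_XX_mul {K : Type*} [CommRing K] (a e : σ → ℕ) {j k : σ} (hjk : j ≠ k) (haj : a j = 1)
    (hak : a k = 1) (hej : e j = 0) (hek : e k = 0) :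
    (∏ i, X i ^ a i * (1 + X i) ^ e i : MvPolynomial σ K) =
      X j * X k * ∏ i, X i ^ (Function.update (Function.update a j 0) k 0) i * (1 + X i) ^ e i := by
  have h2 : (X j * X k : MvPolynomial σ K) =
      ∏ i, X i ^ (if i = j then 1 else if i = k then 1 else 0) * (1 + X i) ^ (0 : ℕ) := by
    rw [← Finset.mul_prod_erase Finset.univ _ (Finset.mem_univ j),
      ← Finset.mul_prod_erase _ _ (Finset.mem_erase.mpr ⟨hjk.symm, Finset.mem_univ k⟩)]
    rw [if_pos rfl, if_neg hjk.symm, if_pos rfl, pow_zero, pow_one, mul_one, pow_zero, pow_one, mul_one]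
    rw [Finset.prod_eq_one fun i hi => ?_, mul_one]
    obtain ⟨hik, hi'⟩ := Finset.mem_erase.mp hi
    obtain ⟨hij, -⟩ := Finset.mem_erase.mp hi'
    rw [if_neg hij, if_neg hik, pow_zero, pow_zero, mul_one]
  rw [h2, prod_mul_prod]
  refine Finset.prod_congr rfl fun i _ => ?_
  by_cases hij : i = j
  · subst hij
    rw [if_pos rfl, Function.update_of_ne hjk, Function.update_self, haj, hej]
  · by_cases hik : i = k
    · subst hik
      rw [if_neg hij, if_pos rfl, Function.update_self, hak, hek]
    · rw [if_neg hij, if_neg hik, Function.update_of_ne hik, Function.update_of_ne hij, zero_add, zero_add]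

/-- The cofactor `N(ã, e)` (with `ã_j = ã_k = 0`, `e_j = e_k = 0`) is supported off `{j, k}`. [folklore] -/
theorem support_cofactor_off {K : Type*} [CommRing K] (a e : σ → ℕ) {j k : σ} (hej : e j = 0) (hek : e k = 0) :
    ∀ d ∈ (∏ i, X i ^ (Function.update (Function.update a j 0) k 0) i * (1 + X i) ^ e i :
      MvPolynomial σ K).support, ∀ i ∈ ({j, k} : Finset σ), d i = 0 := by
  classical
  intro d hd i hi
  -- write the product as the product over `univ \\ {j,k}` (the `j`,`k` factors are `1`)
  have hsplit : (∏ i, X i ^ (Function.update (Function.update a j 0) k 0) i * (1 + X i) ^ e i :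
      MvPolynomial σ K) =
      ∏ i ∈ Finset.univ \ {j, k}, X i ^ (Function.update (Function.update a j 0) k 0) i * (1 + X i) ^ e i := by
    rw [← Finset.prod_sdiff (Finset.subset_univ ({j, k} : Finset σ))]
    rw [Finset.prod_eq_one (s := ({j, k} : Finset σ)) fun i hi => ?_, mul_one]
    rcases Finset.mem_insert.mp hi with rfl | hi
    · by_cases hjk : i = k
      · subst hjk; rw [Function.update_self, hek, pow_zero, pow_zero, mul_one]
      · rw [Function.update_of_ne hjk, Function.update_self, hej, pow_zero, pow_zero, mul_one]
    · rw [Finset.mem_singleton.mp hi, Function.update_self, hek, pow_zero, pow_zero, mul_one]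
  rw [hsplit] at hd
  exact apply_eq_zero_of_mem_support_prod _ _ e hd (fun h => (Finset.mem_sdiff.mp h).2 hi)

/-! ## 2. The chart `x_j` of the pair centre -/

omit [Fintype σ] in
/-- `chartTransform 2 {j,k} j (x_j x_k) = x_k`. [folklore] -/
theorem chartTransform_pair_XX {K : Type*} [CommRing K] {j k : σ} (hjk : j ≠ k) :
    chartTransform 2 {j, k} j (X j * X k : MvPolynomial σ K) = X k := by
  have hXX : (X j * X k : MvPolynomial σ K) = monomial (Finsupp.single j 1 + Finsupp.single k 1) 1 := by
    rw [X, X, monomial_mul, one_mul]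
  have hexp : chartExponent 2 {j, k} j (Finsupp.single j 1 + Finsupp.single k 1) = Finsupp.single k 1 := by
    rw [chartExponent_eq_iff]
    refine ⟨?_, fun i hij => ?_⟩
    · rw [degIn_pair hjk]
      simp [hjk, hjk.symm]
    · simp [Finsupp.single_apply, Ne.symm hij]
  rw [hXX, chartTransform_monomial, X, hexp]

/-- **(U2) The uncleaned transform of the pair move** `{x_j, x_k}`, chart `x_j`, translation `b`:
`F⁺ = N(a′,e′)` with `a′ = swap_b(a with a_j := 0)`, `e′ = swap_b e`. [folklore] -/
theorem pointTransform_pair (s : CState σ (ZMod 2)) (a e : σ → ℕ)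
    (hF : s.F = ∏ i, X i ^ a i * (1 + X i) ^ e i) {j k : σ} (hjk : j ≠ k) (haj : a j = 1) (hak : a k = 1)
    (hej : e j = 0) (hek : e k = 0) (b : σ → ZMod 2) :
    pointTransform 2 {j, k} j b s =
      ∏ i, X i ^ (if b i = 0 then Function.update a j 0 i else e i) *
        (1 + X i) ^ (if b i = 0 then e i else Function.update a j 0 i) := by
  unfold pointTransform
  rw [hF, prod_eq_XX_mul a e hjk haj hak hej hek,
    MohAlong.chartTransform_mul_offS (Finset.mem_insert_self j {k}) 2 _ _ (support_cofactor_off a e hej hek),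
    chartTransform_pair_XX hjk]
  -- `x_k · N(ã, e) = N(ã + δ_k, e) = N(a with a_j := 0, e)`
  have hXk : (X k : MvPolynomial σ (ZMod 2)) * ∏ i, X i ^ (Function.update (Function.update a j 0) k 0) i *
      (1 + X i) ^ e i = ∏ i, X i ^ (Function.update a j 0) i * (1 + X i) ^ e i := by
    have hX : (X k : MvPolynomial σ (ZMod 2)) = ∏ i, X i ^ (if i = k then 1 else 0) * (1 + X i) ^ (0 : ℕ) := by
      rw [← Finset.mul_prod_erase Finset.univ _ (Finset.mem_univ k), if_pos rfl, pow_one, pow_zero, mul_one,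
        Finset.prod_eq_one fun i hi => ?_, mul_one]
      rw [if_neg (Finset.ne_of_mem_erase hi), pow_zero, pow_zero, mul_one]
    rw [hX, prod_mul_prod]
    refine Finset.prod_congr rfl fun i _ => ?_
    by_cases hik : i = k
    · subst hik; rw [if_pos rfl, Function.update_self, Function.update_of_ne hjk.symm, hak, zero_add]
    · rw [if_neg hik, Function.update_of_ne hik, zero_add, zero_add]
  rw [hXk, translate_prod_zmod2]

/-- **(U2, α)** With a purely odd factor in the transform the cleaning deletes nothing. [folklore] -/
theorem step_F_pair_of_purelyOdd (s : CState σ (ZMod 2)) (a e : σ → ℕ)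
    (hF : s.F = ∏ i, X i ^ a i * (1 + X i) ^ e i) {j k : σ} (hjk : j ≠ k) (haj : a j = 1) (hak : a k = 1)
    (hej : e j = 0) (hek : e k = 0) (b : σ → ZMod 2) {l : σ}
    (ha : (if b l = 0 then Function.update a j 0 l else e l) % 2 = 1)
    (he : (if b l = 0 then e l else Function.update a j 0 l) % 2 = 0) :
    (step 2 {j, k} j b s).F =
      ∏ i, X i ^ (if b i = 0 then Function.update a j 0 i else e i) *
        (1 + X i) ^ (if b i = 0 then e i else Function.update a j 0 i) := by
  change deletePthPowers 2 (pointTransform 2 {j, k} j b s) = _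
  rw [pointTransform_pair s a e hF hjk haj hak hej hek b]
  have h := sub_deletePthPowers_of_purelyOdd (fun i => if b i = 0 then Function.update a j 0 i else e i)
    (fun i => if b i = 0 then e i else Function.update a j 0 i) (k := l) ha he
  exact (sub_eq_zero.mp h).symm

/-- **(U2, β)** If every exponent `a′ᵢ` of the transform is even, `F′ = N(a′,e′) − N(a′,ê)`. [folklore] -/
theorem step_F_pair_of_forall_even (s : CState σ (ZMod 2)) (a e : σ → ℕ)
    (hF : s.F = ∏ i, X i ^ a i * (1 + X i) ^ e i) {j k : σ} (hjk : j ≠ k) (haj : a j = 1) (hak : a k = 1)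
    (hej : e j = 0) (hek : e k = 0) (b : σ → ZMod 2)
    (ha : ∀ i, (if b i = 0 then Function.update a j 0 i else e i) % 2 = 0) :
    (step 2 {j, k} j b s).F =
      (∏ i, X i ^ (if b i = 0 then Function.update a j 0 i else e i) *
          (1 + X i) ^ (if b i = 0 then e i else Function.update a j 0 i)) -
        ∏ i, X i ^ (if b i = 0 then Function.update a j 0 i else e i) *
          (1 + X i) ^ ((if b i = 0 then e i else Function.update a j 0 i) -
            (if b i = 0 then e i else Function.update a j 0 i) % 2) := by
  change deletePthPowers 2 (pointTransform 2 {j, k} j b s) = _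
  rw [pointTransform_pair s a e hF hjk haj hak hej hek b]
  have h := sub_deletePthPowers_of_forall_even (fun i => if b i = 0 then Function.update a j 0 i else e i)
    (fun i => if b i = 0 then e i else Function.update a j 0 i) ha
  rw [← h, sub_sub_cancel]

end PureLeafNF

end Summit.ResolutionOfSingularities.ResolutionOfSingularities.Theorems.PIDim4

end
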